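import Mathlib
import Literature.Analysis.FluidPDE.GaussianVortexPlanar
import HarnessLib
import Summits.AnomalousDissipation.AnomalousDissipation.Theorems.MarginalStabilityChainStretchedVortexRowsStubLogPotentialTools
import Summits.AnomalousDissipation.AnomalousDissipation.Theorems.MarginalStabilityChainStretchedVortexRowsStubLogPotentialGradient
import Summits.AnomalousDissipation.AnomalousDissipation.Theorems.MarginalStabilityChainStretchedVortexRowsStubLogPotentialGreen
import Summits.AnomalousDissipation.AnomalousDissipation.Theorems.MarginalStabilityChainStretchedVortexRowsStubLogPotentialDecay
import Summits.AnomalousDissipation.AnomalousDissipation.Theorems.MarginalStabilityChainStretchedVortexRowsStubLogPotentialSymmetry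

/-!
# `cellStream_classInvariance` — registered helper stub toward `stub_cellStreamSolvability`
(crux stmt-AnomalousDissipation-3009 `MarginalStabilityChain.StretchedVortexRows`, line `braid-closed-large-circulation-gluing`)

Bookkeeping on top of the landed `C¹` theory of the logarithmic potential `ψ = N ∗ g`,
`N = (2π)⁻¹ log ‖·‖`, of a `C¹` density of the Gaussian class `|g|, ‖Dg‖ ≤ B e^{−‖η‖²/8}` on
`ℝ² = EuclideanSpace ℝ (Fin 2)` (files `…StubLogPotentialTools/Gradient/Green/Symmetry`). With
`V = 4πG/φ(‖ξ‖²/4)` and `q = √V` (whose calculus — `q ∈ C^∞`, `0 < q ≤ (1 + ‖ξ‖) e^{−‖ξ‖²/8}`,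
`‖Dq‖ ≤ 2 (1 + ‖ξ‖)³ e^{−‖ξ‖²/8}`, `q` radial — is the HYPOTHESIS of the registered statement) we prove:

* the symmetric Gaussian class `𝒩_S(B)` (`h ∈ C¹`, `|h| + ‖Dh‖ ≤ B e^{−‖ξ‖²/16}`, `h` even, zero circular
  means) is mapped into `⋃_{B'} 𝒩_S(B')` by `T h = q · N ∗ (q h)`;
* the datum `h₀ = q · N ∗ F` of an even, circular-mean-free `F ∈ C¹` with `|F| + ‖∇F‖ ≤ C (1 + ‖ξ‖)^j G` lies
  in the class.

Route. For a density `g` of the Gaussian class (`g = q h`, resp. `g = F` after `gaussClass_reduce`):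
`ψ = N ∗ g ∈ C¹` (`logPotential_contDiff_one`), `|ψ(ξ)| ≤ C (1 + log (1 + ‖ξ‖)) ≤ C (1 + ‖ξ‖)`
(`abs_logPotential_le`), `‖Dψ(ξ)‖ = ‖∇ψ(ξ)‖ ≤ ∫ ‖g(η) DN(ξ − η)‖ dη ≤ M` (`logPotential_gradient_eq`,
`exists_integral_norm_smul_gradLogKernel_le`), `ψ` even with zero circular means (`logPotential_even_circMean`).
Then `T = q ψ` is `C¹` by the product rule with
`|T| + ‖DT‖ ≤ (3C + M) (1 + ‖ξ‖)⁴ e^{−‖ξ‖²/8} ≤ B' e^{−‖ξ‖²/16}`, even (`q` radial hence even) and with zero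
circular means (`q` is constant on circles). The density `q h` is `C¹` with
`|q h|, ‖D(q h)‖ ≤ 3 B K e^{−‖η‖²/8}` (`(1 + ‖η‖)³ e^{−‖η‖²/16} ≤ K`), even and circular-mean free.

References: Gallay–Wayne, *Comm. Math. Phys.* 255 (2005) and *Arch. Ration. Mech. Anal.* 2007 (the cell
problem at the Gaussian vortex); the estimates here are elementary.
-/

set_option linter.dupNamespace false

noncomputable section

open scoped BigOperators Topology RealInnerProductSpace ContDiff Laplacian
open Filter Set Function MeasureTheory WithLp

namespace Summit.AnomalousDissipation.AnomalousDissipation.Theorems.MarginalStabilityChainStretchedVortexRows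

open Literature.Analysis.FluidPDE

/-! ### Elementary Gaussian absorption bounds -/

/-- `(1 + t)^N e^{−t²/8} ≤ K_N e^{−t²/16}` for `t ≥ 0`. [folklore] -/
theorem classInv_pow_mul_exp_eighth_le (N : ℕ) :
    ∃ K : ℝ, 0 ≤ K ∧ ∀ t : ℝ, 0 ≤ t →
      (1 + t) ^ N * Real.exp (-(1 / 8) * t ^ 2) ≤ K * Real.exp (-(1 / 16) * t ^ 2) := by
  refine ⟨N.factorial * (4 / (1 / 8)) ^ N * Real.exp ((1 / 8) / 2), by positivity, fun t ht => ?_⟩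
  have h := PineauVicol2026.one_add_pow_mul_exp_neg_mul_sq_le (c := 1 / 8) (by norm_num) N ht
  have e : -((1 / 8 : ℝ) / 2) * t ^ 2 = -(1 / 16) * t ^ 2 := by ring
  rwa [e] at h

/-- `(1 + t)^N e^{−t²/16} ≤ K_N` for `t ≥ 0`. [folklore] -/
theorem classInv_pow_mul_exp_sixteenth_le (N : ℕ) :
    ∃ K : ℝ, 0 ≤ K ∧ ∀ t : ℝ, 0 ≤ t → (1 + t) ^ N * Real.exp (-(1 / 16) * t ^ 2) ≤ K := by
  refine ⟨N.factorial * (4 / (1 / 16)) ^ N * Real.exp ((1 / 16) / 2), by positivity, fun t ht => ?_⟩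
  have h := PineauVicol2026.one_add_pow_mul_exp_neg_mul_sq_le (c := 1 / 16) (by norm_num) N ht
  have h1 : Real.exp (-((1 / 16 : ℝ) / 2) * t ^ 2) ≤ 1 :=
    Real.exp_le_one_iff.2 (by nlinarith [sq_nonneg t])
  have h0 : (0:ℝ) ≤ N.factorial * (4 / (1 / 16)) ^ N * Real.exp ((1 / 16) / 2) := by positivity
  calc (1 + t) ^ N * Real.exp (-(1 / 16) * t ^ 2) ≤ _ := h
    _ ≤ N.factorial * (4 / (1 / 16)) ^ N * Real.exp ((1 / 16) / 2) * 1 := by gcongr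
    _ = _ := mul_one _

/-! ### Radial multipliers preserve evenness and zero circular means -/

/-- The circle point `(r cos θ, r sin θ)` has the same norm as `(r, 0)`. [folklore] -/
theorem classInv_norm_circlePoint (r θ : ℝ) :
    ‖(toLp 2 ![r * Real.cos θ, r * Real.sin θ] : EuclideanSpace ℝ (Fin 2))‖ =
      ‖(toLp 2 ![r, 0] : EuclideanSpace ℝ (Fin 2))‖ := by
  rw [circlePoint_eq_rotation,
    MarginalStabilityChainStretchedVortexRows.norm_cos_smul_add_sin_smul_perp (toLp 2 ![r, 0]) θ]

/-- A radial factor `q` preserves evenness and zero circular means: if `f` is even with zero circular means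
then so is `q · f`. [folklore] -/
theorem classInv_even_circ {q f : EuclideanSpace ℝ (Fin 2) → ℝ}
    (hqrad : ∀ ξ η : EuclideanSpace ℝ (Fin 2), ‖ξ‖ = ‖η‖ → q ξ = q η)
    (heven : ∀ ξ, f (-ξ) = f ξ)
    (hcirc : ∀ r, 0 < r →
      ∫ θ in (0:ℝ)..(2 * Real.pi), f (toLp 2 ![r * Real.cos θ, r * Real.sin θ]) = 0) :
    (∀ ξ, q (-ξ) * f (-ξ) = q ξ * f ξ) ∧
      ∀ r, 0 < r → ∫ θ in (0:ℝ)..(2 * Real.pi),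
        q (toLp 2 ![r * Real.cos θ, r * Real.sin θ]) * f (toLp 2 ![r * Real.cos θ, r * Real.sin θ]) = 0 := by
  refine ⟨fun ξ => by rw [heven ξ, hqrad (-ξ) ξ (norm_neg ξ)], fun r hr => ?_⟩
  have hK : ∀ θ : ℝ, q (toLp 2 ![r * Real.cos θ, r * Real.sin θ]) = q (toLp 2 ![r, 0]) := fun θ =>
    hqrad _ _ (classInv_norm_circlePoint r θ)
  simp_rw [hK]
  rw [intervalIntegral.integral_const_mul, hcirc r hr, mul_zero]

/-! ### The product `T = q · ψ` -/

/-- **Product estimate.** For a `C¹` radial factor `q` with `|q| ≤ (1 + ‖ξ‖) e^{−‖ξ‖²/8}`,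
`‖Dq‖ ≤ 2 (1 + ‖ξ‖)³ e^{−‖ξ‖²/8}` and a `C¹` function `ψ` with `|ψ| ≤ C (1 + ‖ξ‖)`, `‖Dψ‖ ≤ M`, `ψ` even with
zero circular means, the product `T = q ψ` is `C¹`, `|T| + ‖DT‖ ≤ B' e^{−‖ξ‖²/16}`, even, with zero circular
means. [folklore] -/
theorem classInv_product {q ψ : EuclideanSpace ℝ (Fin 2) → ℝ} {C M : ℝ}
    (hqC : ContDiff ℝ 1 q)
    (hq0 : ∀ ξ, |q ξ| ≤ (1 + ‖ξ‖) * Real.exp (-(1 / 8) * ‖ξ‖ ^ 2))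
    (hq1 : ∀ ξ, ‖fderiv ℝ q ξ‖ ≤ 2 * (1 + ‖ξ‖) ^ 3 * Real.exp (-(1 / 8) * ‖ξ‖ ^ 2))
    (hqrad : ∀ ξ η : EuclideanSpace ℝ (Fin 2), ‖ξ‖ = ‖η‖ → q ξ = q η)
    (hψC : ContDiff ℝ 1 ψ) (hC0 : 0 ≤ C) (hM0 : 0 ≤ M)
    (hψ0 : ∀ ξ, |ψ ξ| ≤ C * (1 + ‖ξ‖)) (hψ1 : ∀ ξ, ‖fderiv ℝ ψ ξ‖ ≤ M)
    (hψeven : ∀ ξ, ψ (-ξ) = ψ ξ)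
    (hψcirc : ∀ r, 0 < r →
      ∫ θ in (0:ℝ)..(2 * Real.pi), ψ (toLp 2 ![r * Real.cos θ, r * Real.sin θ]) = 0) :
    ContDiff ℝ 1 (fun ξ => q ξ * ψ ξ) ∧
      (∃ B' : ℝ, ∀ ξ, |q ξ * ψ ξ| + ‖fderiv ℝ (fun ξ => q ξ * ψ ξ) ξ‖ ≤
        B' * Real.exp (-(1 / 16) * ‖ξ‖ ^ 2)) ∧
      (∀ ξ, q (-ξ) * ψ (-ξ) = q ξ * ψ ξ) ∧
      ∀ r, 0 < r → ∫ θ in (0:ℝ)..(2 * Real.pi),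
        q (toLp 2 ![r * Real.cos θ, r * Real.sin θ]) * ψ (toLp 2 ![r * Real.cos θ, r * Real.sin θ]) = 0 := by
  obtain ⟨K, hK0, hK⟩ := classInv_pow_mul_exp_eighth_le 4
  refine ⟨hqC.mul hψC, ⟨(3 * C + M) * K, fun ξ => ?_⟩, classInv_even_circ hqrad hψeven hψcirc⟩
  have hdq : DifferentiableAt ℝ q ξ := (hqC.differentiable one_ne_zero) ξ
  have hdψ : DifferentiableAt ℝ ψ ξ := (hψC.differentiable one_ne_zero) ξ
  have hnorm : ‖fderiv ℝ (fun ξ => q ξ * ψ ξ) ξ‖ ≤ |q ξ| * ‖fderiv ℝ ψ ξ‖ + |ψ ξ| * ‖fderiv ℝ q ξ‖ := by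
    rw [fderiv_fun_mul hdq hdψ]
    refine (norm_add_le _ _).trans (le_of_eq ?_)
    rw [norm_smul, norm_smul, Real.norm_eq_abs, Real.norm_eq_abs]
  have e8 := Real.exp_pos (-(1 / 8) * ‖ξ‖ ^ 2)
  have h1t : (1:ℝ) ≤ 1 + ‖ξ‖ := by linarith [norm_nonneg ξ]
  have hp1 : (1 + ‖ξ‖) ≤ (1 + ‖ξ‖) ^ 4 := le_self_pow₀ h1t (by norm_num)
  have hp2 : (1 + ‖ξ‖) ^ 2 ≤ (1 + ‖ξ‖) ^ 4 := pow_le_pow_right₀ h1t (by norm_num)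
  have i1 : |q ξ| * |ψ ξ| ≤ ((1 + ‖ξ‖) * Real.exp (-(1 / 8) * ‖ξ‖ ^ 2)) * (C * (1 + ‖ξ‖)) :=
    mul_le_mul (hq0 ξ) (hψ0 ξ) (abs_nonneg _) (by positivity)
  have i2 : |q ξ| * ‖fderiv ℝ ψ ξ‖ ≤ ((1 + ‖ξ‖) * Real.exp (-(1 / 8) * ‖ξ‖ ^ 2)) * M :=
    mul_le_mul (hq0 ξ) (hψ1 ξ) (norm_nonneg _) (by positivity)
  have i3 : |ψ ξ| * ‖fderiv ℝ q ξ‖ ≤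
      (C * (1 + ‖ξ‖)) * (2 * (1 + ‖ξ‖) ^ 3 * Real.exp (-(1 / 8) * ‖ξ‖ ^ 2)) :=
    mul_le_mul (hψ0 ξ) (hq1 ξ) (norm_nonneg _) (by positivity)
  have hpoly := hK ‖ξ‖ (norm_nonneg ξ)
  calc |q ξ * ψ ξ| + ‖fderiv ℝ (fun ξ => q ξ * ψ ξ) ξ‖
      ≤ |q ξ| * |ψ ξ| + (|q ξ| * ‖fderiv ℝ ψ ξ‖ + |ψ ξ| * ‖fderiv ℝ q ξ‖) := by
        rw [abs_mul]; exact add_le_add le_rfl hnorm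
    _ ≤ ((1 + ‖ξ‖) * Real.exp (-(1 / 8) * ‖ξ‖ ^ 2)) * (C * (1 + ‖ξ‖)) +
          (((1 + ‖ξ‖) * Real.exp (-(1 / 8) * ‖ξ‖ ^ 2)) * M +
            (C * (1 + ‖ξ‖)) * (2 * (1 + ‖ξ‖) ^ 3 * Real.exp (-(1 / 8) * ‖ξ‖ ^ 2))) :=
        add_le_add i1 (add_le_add i2 i3)
    _ = (C * (1 + ‖ξ‖) ^ 2 + M * (1 + ‖ξ‖) + 2 * C * (1 + ‖ξ‖) ^ 4) *
          Real.exp (-(1 / 8) * ‖ξ‖ ^ 2) := by ring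
    _ ≤ (C * (1 + ‖ξ‖) ^ 4 + M * (1 + ‖ξ‖) ^ 4 + 2 * C * (1 + ‖ξ‖) ^ 4) *
          Real.exp (-(1 / 8) * ‖ξ‖ ^ 2) := by
        apply mul_le_mul_of_nonneg_right _ e8.le
        have a1 := mul_le_mul_of_nonneg_left hp2 hC0
        have a2 := mul_le_mul_of_nonneg_left hp1 hM0
        linarith
    _ = (3 * C + M) * ((1 + ‖ξ‖) ^ 4 * Real.exp (-(1 / 8) * ‖ξ‖ ^ 2)) := by ring
    _ ≤ (3 * C + M) * (K * Real.exp (-(1 / 16) * ‖ξ‖ ^ 2)) :=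
        mul_le_mul_of_nonneg_left hpoly (by positivity)
    _ = (3 * C + M) * K * Real.exp (-(1 / 16) * ‖ξ‖ ^ 2) := by ring

/-! ### The logarithmic potential of a Gaussian-class density -/

/-- For a `C¹` density with `|g|, ‖Dg‖ ≤ B e^{−‖η‖²/8}`: `ψ = N ∗ g ∈ C¹`, `|ψ(ξ)| ≤ C (1 + ‖ξ‖)` and
`‖Dψ(ξ)‖ ≤ M` (`‖Dψ‖ = ‖∇ψ‖ ≤ ∫ ‖g(η) DN(ξ − η)‖ dη`). [folklore] -/
theorem classInv_psi {B : ℝ} {g : EuclideanSpace ℝ (Fin 2) → ℝ} (hg : ContDiff ℝ 1 g)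
    (hg0 : ∀ η, |g η| ≤ B * Real.exp (-(1 / 8) * ‖η‖ ^ 2))
    (hg1 : ∀ η, ‖fderiv ℝ g η‖ ≤ B * Real.exp (-(1 / 8) * ‖η‖ ^ 2)) :
    ContDiff ℝ 1 (fun ξ : EuclideanSpace ℝ (Fin 2) => ∫ η, (2 * Real.pi)⁻¹ * Real.log ‖ξ - η‖ * g η) ∧
    ∃ C M : ℝ, 0 ≤ C ∧ 0 ≤ M ∧
      (∀ ξ : EuclideanSpace ℝ (Fin 2),
        |∫ η, (2 * Real.pi)⁻¹ * Real.log ‖ξ - η‖ * g η| ≤ C * (1 + ‖ξ‖)) ∧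
      ∀ ξ : EuclideanSpace ℝ (Fin 2),
        ‖fderiv ℝ (fun ξ : EuclideanSpace ℝ (Fin 2) =>
          ∫ η, (2 * Real.pi)⁻¹ * Real.log ‖ξ - η‖ * g η) ξ‖ ≤ M := by
  refine ⟨(logPotential_contDiff_one B g hg hg0 hg1).1, ?_⟩
  obtain ⟨C, hC0, hC⟩ := abs_logPotential_le hg0
  obtain ⟨M, hM⟩ := exists_integral_norm_smul_gradLogKernel_le hg0 hg.continuous
  have hM0 : 0 ≤ M := le_trans (integral_nonneg fun η => norm_nonneg _) (hM 0)
  refine ⟨C, M, hC0, hM0, fun ξ => ?_, fun ξ => ?_⟩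
  · have hlog : Real.log (1 + ‖ξ‖) ≤ ‖ξ‖ := by
      have := Real.log_le_sub_one_of_pos (by positivity : (0:ℝ) < 1 + ‖ξ‖)
      linarith
    calc _ ≤ C * (1 + Real.log (1 + ‖ξ‖)) := hC ξ
      _ ≤ C * (1 + ‖ξ‖) := by gcongr
  · obtain ⟨-, hgrad⟩ := logPotential_gradient_eq B g hg hg0 hg1 ξ
    -- `‖Df(ξ)‖ = ‖∇f(ξ)‖`: the gradient is the Riesz image of the Fréchet derivative
    have key : ∀ (f : EuclideanSpace ℝ (Fin 2) → ℝ) (x : EuclideanSpace ℝ (Fin 2)),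
        ‖gradient f x‖ = ‖fderiv ℝ f x‖ := fun f x => by
      rw [gradient, LinearIsometryEquiv.norm_map]
    rw [← key, hgrad]
    exact (norm_integral_le_integral_norm _).trans (hM ξ)

/-- **Core lemma.** For `q` as in `classInv_product` and a `C¹` density `g` with `|g|, ‖Dg‖ ≤ B e^{−‖η‖²/8}`,
even with zero circular means, `T = q · N ∗ g` is `C¹`, `|T| + ‖DT‖ ≤ B' e^{−‖ξ‖²/16}`, even, with zero
circular means. [folklore] -/
theorem classInv_core {q : EuclideanSpace ℝ (Fin 2) → ℝ}
    (hqC : ContDiff ℝ 1 q)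
    (hq0 : ∀ ξ, |q ξ| ≤ (1 + ‖ξ‖) * Real.exp (-(1 / 8) * ‖ξ‖ ^ 2))
    (hq1 : ∀ ξ, ‖fderiv ℝ q ξ‖ ≤ 2 * (1 + ‖ξ‖) ^ 3 * Real.exp (-(1 / 8) * ‖ξ‖ ^ 2))
    (hqrad : ∀ ξ η : EuclideanSpace ℝ (Fin 2), ‖ξ‖ = ‖η‖ → q ξ = q η)
    {B : ℝ} {g : EuclideanSpace ℝ (Fin 2) → ℝ} (hg : ContDiff ℝ 1 g)
    (hg0 : ∀ η, |g η| ≤ B * Real.exp (-(1 / 8) * ‖η‖ ^ 2))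
    (hg1 : ∀ η, ‖fderiv ℝ g η‖ ≤ B * Real.exp (-(1 / 8) * ‖η‖ ^ 2))
    (heven : ∀ η, g (-η) = g η)
    (hcirc : ∀ r, 0 < r →
      ∫ θ in (0:ℝ)..(2 * Real.pi), g (toLp 2 ![r * Real.cos θ, r * Real.sin θ]) = 0) :
    let T : EuclideanSpace ℝ (Fin 2) → ℝ := fun ξ =>
      q ξ * ∫ η, (2 * Real.pi)⁻¹ * Real.log ‖ξ - η‖ * g η
    ContDiff ℝ 1 T ∧
      (∃ B' : ℝ, ∀ ξ, |T ξ| + ‖fderiv ℝ T ξ‖ ≤ B' * Real.exp (-(1 / 16) * ‖ξ‖ ^ 2)) ∧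
      (∀ ξ, T (-ξ) = T ξ) ∧
      (∀ r, 0 < r → ∫ θ in (0:ℝ)..(2 * Real.pi), T (toLp 2 ![r * Real.cos θ, r * Real.sin θ]) = 0) := by
  obtain ⟨hψC, C, M, hC0, hM0, hψ0, hψ1⟩ := classInv_psi hg hg0 hg1
  obtain ⟨hψeven, hψcirc⟩ := logPotential_even_circMean B g hg.continuous hg0 heven hcirc
  exact classInv_product hqC hq0 hq1 hqrad hψC hC0 hM0 hψ0 hψ1 hψeven hψcirc

/-! ### The density `q · h` for `h ∈ 𝒩_S(B)` -/

/-- For `h ∈ C¹` with `|h| + ‖Dh‖ ≤ B e^{−‖ξ‖²/16}` and `q` as in `classInv_product`, the density `q h` is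
`C¹` with `|q h|, ‖D(q h)‖ ≤ B₁ e^{−‖η‖²/8}`. [folklore] -/
theorem classInv_qh {q h : EuclideanSpace ℝ (Fin 2) → ℝ} {B : ℝ}
    (hqC : ContDiff ℝ 1 q)
    (hq0 : ∀ ξ, |q ξ| ≤ (1 + ‖ξ‖) * Real.exp (-(1 / 8) * ‖ξ‖ ^ 2))
    (hq1 : ∀ ξ, ‖fderiv ℝ q ξ‖ ≤ 2 * (1 + ‖ξ‖) ^ 3 * Real.exp (-(1 / 8) * ‖ξ‖ ^ 2))
    (hh : ContDiff ℝ 1 h)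
    (hb : ∀ ξ, |h ξ| + ‖fderiv ℝ h ξ‖ ≤ B * Real.exp (-(1 / 16) * ‖ξ‖ ^ 2)) :
    ContDiff ℝ 1 (fun η => q η * h η) ∧
      ∃ B₁ : ℝ, (∀ η, |q η * h η| ≤ B₁ * Real.exp (-(1 / 8) * ‖η‖ ^ 2)) ∧
        ∀ η, ‖fderiv ℝ (fun η => q η * h η) η‖ ≤ B₁ * Real.exp (-(1 / 8) * ‖η‖ ^ 2) := by
  obtain ⟨K, hK0, hK⟩ := classInv_pow_mul_exp_sixteenth_le 3
  have hB : 0 ≤ B := by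
    have h0 := hb 0
    have h1 : (0:ℝ) ≤ |h 0| + ‖fderiv ℝ h 0‖ := by positivity
    have e : Real.exp (-(1 / 16) * ‖(0 : EuclideanSpace ℝ (Fin 2))‖ ^ 2) = 1 := by simp
    rw [e, mul_one] at h0
    linarith
  have hK1 : ∀ η : EuclideanSpace ℝ (Fin 2), (1 + ‖η‖) * Real.exp (-(1 / 16) * ‖η‖ ^ 2) ≤ K := fun η =>
    have h1s : (1:ℝ) ≤ 1 + ‖η‖ := by linarith [norm_nonneg η]
    le_trans (mul_le_mul_of_nonneg_right (le_self_pow₀ h1s (by norm_num)) (Real.exp_pos _).le)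
      (hK ‖η‖ (norm_nonneg η))
  have hh0 : ∀ η, |h η| ≤ B * Real.exp (-(1 / 16) * ‖η‖ ^ 2) := fun η =>
    le_trans (le_add_of_nonneg_right (norm_nonneg _)) (hb η)
  have hh1 : ∀ η, ‖fderiv ℝ h η‖ ≤ B * Real.exp (-(1 / 16) * ‖η‖ ^ 2) := fun η =>
    le_trans (le_add_of_nonneg_left (abs_nonneg _)) (hb η)
  refine ⟨hqC.mul hh, 3 * B * K, fun η => ?_, fun η => ?_⟩
  · rw [abs_mul]
    calc |q η| * |h η|
        ≤ ((1 + ‖η‖) * Real.exp (-(1 / 8) * ‖η‖ ^ 2)) * (B * Real.exp (-(1 / 16) * ‖η‖ ^ 2)) :=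
          mul_le_mul (hq0 η) (hh0 η) (abs_nonneg _) (by positivity)
      _ = B * ((1 + ‖η‖) * Real.exp (-(1 / 16) * ‖η‖ ^ 2)) * Real.exp (-(1 / 8) * ‖η‖ ^ 2) := by ring
      _ ≤ B * K * Real.exp (-(1 / 8) * ‖η‖ ^ 2) := by gcongr; exact hK1 η
      _ ≤ 3 * B * K * Real.exp (-(1 / 8) * ‖η‖ ^ 2) := by
          have : 0 ≤ B * K * Real.exp (-(1 / 8) * ‖η‖ ^ 2) := by positivity
          nlinarith
  · have hdq : DifferentiableAt ℝ q η := (hqC.differentiable one_ne_zero) η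
    have hdh : DifferentiableAt ℝ h η := (hh.differentiable one_ne_zero) η
    have hK3 := hK ‖η‖ (norm_nonneg η)
    have hK1η := hK1 η
    rw [fderiv_fun_mul hdq hdh]
    calc ‖q η • fderiv ℝ h η + h η • fderiv ℝ q η‖
        ≤ ‖q η • fderiv ℝ h η‖ + ‖h η • fderiv ℝ q η‖ := norm_add_le _ _
      _ = |q η| * ‖fderiv ℝ h η‖ + |h η| * ‖fderiv ℝ q η‖ := by
          rw [norm_smul, norm_smul, Real.norm_eq_abs, Real.norm_eq_abs]
      _ ≤ ((1 + ‖η‖) * Real.exp (-(1 / 8) * ‖η‖ ^ 2)) * (B * Real.exp (-(1 / 16) * ‖η‖ ^ 2)) +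
            (B * Real.exp (-(1 / 16) * ‖η‖ ^ 2)) * (2 * (1 + ‖η‖) ^ 3 * Real.exp (-(1 / 8) * ‖η‖ ^ 2)) :=
          add_le_add (mul_le_mul (hq0 η) (hh1 η) (norm_nonneg _) (by positivity))
            (mul_le_mul (hh0 η) (hq1 η) (norm_nonneg _) (by positivity))
      _ = B * (((1 + ‖η‖) * Real.exp (-(1 / 16) * ‖η‖ ^ 2)) +
            2 * ((1 + ‖η‖) ^ 3 * Real.exp (-(1 / 16) * ‖η‖ ^ 2))) * Real.exp (-(1 / 8) * ‖η‖ ^ 2) := by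
          ring
      _ ≤ B * (K + 2 * K) * Real.exp (-(1 / 8) * ‖η‖ ^ 2) := by gcongr
      _ = 3 * B * K * Real.exp (-(1 / 8) * ‖η‖ ^ 2) := by ring

/-! ### The registered statement -/

/-- **`T` preserves the symmetric Gaussian class, and the datum `h₀ = q · (N ∗ F)` lies in it** (registered
helper stub W3 toward `stub_cellStreamSolvability`). Hypothesis: the calculus package of `q = √V`,
`V = 4πG/φ(‖ξ‖²/4)` (`q ∈ C^∞`, `0 < q`, `q² = V`, `e^{−‖ξ‖²/8} ≤ q ≤ (1 + ‖ξ‖) e^{−‖ξ‖²/8}`,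
`‖Dq‖ ≤ 2 (1 + ‖ξ‖)³ e^{−‖ξ‖²/8}`, `q` radial). Conclusions: (1) for `h ∈ C¹` with
`|h| + ‖Dh‖ ≤ B e^{−‖ξ‖²/16}`, even, with zero circular means, `T h = q · N ∗ (q h)` (`N = (2π)⁻¹ log ‖·‖`) is
`C¹`, satisfies `|T h| + ‖D(T h)‖ ≤ B' e^{−‖ξ‖²/16}`, is even and has zero circular means; (2) for `F ∈ C¹` with
`|F| + ‖∇F‖ ≤ C (1 + ‖ξ‖)^j G`, even, with zero circular means, `h₀ = q · N ∗ F` has the same four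
properties. [folklore] -/
theorem cellStream_classInvariance :
    (ContDiff ℝ ∞ (fun ξ : EuclideanSpace ℝ (Fin 2) =>
        Real.sqrt (4 * Real.pi * gaussVortexProfile ξ / burgersPhi (‖ξ‖ ^ 2 / 4))) ∧
      (∀ ξ : EuclideanSpace ℝ (Fin 2),
        0 < Real.sqrt (4 * Real.pi * gaussVortexProfile ξ / burgersPhi (‖ξ‖ ^ 2 / 4))) ∧
      (∀ ξ : EuclideanSpace ℝ (Fin 2),
        Real.sqrt (4 * Real.pi * gaussVortexProfile ξ / burgersPhi (‖ξ‖ ^ 2 / 4)) ^ 2 =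
          4 * Real.pi * gaussVortexProfile ξ / burgersPhi (‖ξ‖ ^ 2 / 4)) ∧
      (∀ ξ : EuclideanSpace ℝ (Fin 2),
        Real.exp (-(1 / 8) * ‖ξ‖ ^ 2) ≤
          Real.sqrt (4 * Real.pi * gaussVortexProfile ξ / burgersPhi (‖ξ‖ ^ 2 / 4))) ∧
      (∀ ξ : EuclideanSpace ℝ (Fin 2),
        Real.sqrt (4 * Real.pi * gaussVortexProfile ξ / burgersPhi (‖ξ‖ ^ 2 / 4)) ≤
          (1 + ‖ξ‖) * Real.exp (-(1 / 8) * ‖ξ‖ ^ 2)) ∧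
      (∀ ξ : EuclideanSpace ℝ (Fin 2),
        ‖fderiv ℝ (fun ξ : EuclideanSpace ℝ (Fin 2) =>
            Real.sqrt (4 * Real.pi * gaussVortexProfile ξ / burgersPhi (‖ξ‖ ^ 2 / 4))) ξ‖ ≤
          2 * (1 + ‖ξ‖) ^ 3 * Real.exp (-(1 / 8) * ‖ξ‖ ^ 2)) ∧
      (∀ ξ η : EuclideanSpace ℝ (Fin 2), ‖ξ‖ = ‖η‖ →
        Real.sqrt (4 * Real.pi * gaussVortexProfile ξ / burgersPhi (‖ξ‖ ^ 2 / 4)) =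
          Real.sqrt (4 * Real.pi * gaussVortexProfile η / burgersPhi (‖η‖ ^ 2 / 4)))) →
    (∀ (B : ℝ) (h : EuclideanSpace ℝ (Fin 2) → ℝ), ContDiff ℝ 1 h →
      (∀ ξ, |h ξ| + ‖fderiv ℝ h ξ‖ ≤ B * Real.exp (-(1 / 16) * ‖ξ‖ ^ 2)) →
      (∀ ξ, h (-ξ) = h ξ) →
      (∀ r, 0 < r → ∫ θ in (0:ℝ)..(2 * Real.pi), h (toLp 2 ![r * Real.cos θ, r * Real.sin θ]) = 0) →
      let Th : EuclideanSpace ℝ (Fin 2) → ℝ := fun ξ =>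
        Real.sqrt (4 * Real.pi * gaussVortexProfile ξ / burgersPhi (‖ξ‖ ^ 2 / 4)) *
          ∫ η, (2 * Real.pi)⁻¹ * Real.log ‖ξ - η‖ *
            (Real.sqrt (4 * Real.pi * gaussVortexProfile η / burgersPhi (‖η‖ ^ 2 / 4)) * h η)
      ContDiff ℝ 1 Th ∧
        (∃ B' : ℝ, ∀ ξ, |Th ξ| + ‖fderiv ℝ Th ξ‖ ≤ B' * Real.exp (-(1 / 16) * ‖ξ‖ ^ 2)) ∧
        (∀ ξ, Th (-ξ) = Th ξ) ∧
        (∀ r, 0 < r → ∫ θ in (0:ℝ)..(2 * Real.pi), Th (toLp 2 ![r * Real.cos θ, r * Real.sin θ]) = 0)) ∧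
    (∀ (j : ℕ) (C : ℝ) (F : EuclideanSpace ℝ (Fin 2) → ℝ), ContDiff ℝ 1 F →
      (∀ ξ, |F ξ| + ‖gradient F ξ‖ ≤ C * (1 + ‖ξ‖) ^ j * gaussVortexProfile ξ) →
      (∀ ξ, F (-ξ) = F ξ) →
      (∀ r, 0 < r → ∫ θ in (0:ℝ)..(2 * Real.pi), F (toLp 2 ![r * Real.cos θ, r * Real.sin θ]) = 0) →
      let h₀ : EuclideanSpace ℝ (Fin 2) → ℝ := fun ξ =>
        Real.sqrt (4 * Real.pi * gaussVortexProfile ξ / burgersPhi (‖ξ‖ ^ 2 / 4)) *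
          ∫ η, (2 * Real.pi)⁻¹ * Real.log ‖ξ - η‖ * F η
      ContDiff ℝ 1 h₀ ∧
        (∃ B' : ℝ, ∀ ξ, |h₀ ξ| + ‖fderiv ℝ h₀ ξ‖ ≤ B' * Real.exp (-(1 / 16) * ‖ξ‖ ^ 2)) ∧
        (∀ ξ, h₀ (-ξ) = h₀ ξ) ∧
        (∀ r, 0 < r → ∫ θ in (0:ℝ)..(2 * Real.pi), h₀ (toLp 2 ![r * Real.cos θ, r * Real.sin θ]) = 0)) := by
  intro hq
  obtain ⟨hqS, hqpos, -, -, hqle, hqD, hqrad⟩ := hq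
  have hqC : ContDiff ℝ 1 (fun ξ : EuclideanSpace ℝ (Fin 2) =>
      Real.sqrt (4 * Real.pi * gaussVortexProfile ξ / burgersPhi (‖ξ‖ ^ 2 / 4))) :=
    hqS.of_le (by exact_mod_cast le_top)
  have hq0 : ∀ ξ : EuclideanSpace ℝ (Fin 2),
      |Real.sqrt (4 * Real.pi * gaussVortexProfile ξ / burgersPhi (‖ξ‖ ^ 2 / 4))| ≤
        (1 + ‖ξ‖) * Real.exp (-(1 / 8) * ‖ξ‖ ^ 2) := fun ξ => by
    rw [abs_of_pos (hqpos ξ)]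
    exact hqle ξ
  refine ⟨fun B h hh hb heven hcirc => ?_, fun j C F hF hb heven hcirc => ?_⟩
  · obtain ⟨hgC, B₁, hg0, hg1⟩ := classInv_qh hqC hq0 hqD hh hb
    obtain ⟨hgeven, hgcirc⟩ := classInv_even_circ hqrad heven hcirc
    exact classInv_core hqC hq0 hqD hqrad hgC hg0 hg1 hgeven hgcirc
  · have hb' : ∀ η, |F η| + ‖fderiv ℝ F η‖ ≤ C * (1 + ‖η‖) ^ j * gaussVortexProfile η := fun η => by
      have key : ‖gradient F η‖ = ‖fderiv ℝ F η‖ := by rw [gradient, LinearIsometryEquiv.norm_map]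
      rw [← key]
      exact hb η
    obtain ⟨B₁, -, hg0, hg1⟩ := gaussClass_reduce hb'
    exact classInv_core hqC hq0 hqD hqrad hF hg0 hg1 heven hcirc

end Summit.AnomalousDissipation.AnomalousDissipation.Theorems.MarginalStabilityChainStretchedVortexRows

end
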